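import Summits.HodgeConjecture.CorCM.DihedralSexticPairCurveHodgeOfMarkman
import Summits.HodgeConjecture.CorCM.DihedralSexticPairHodgeOfMarkmanNonGalois
import Summits.HodgeConjecture.CorCM.QuadraticCMTypeSlice
import HarnessLib

/-!
# COR-CM — the Hodge conjecture, modulo Markman's fourfold theorem, for `E × B₀ × B₁`: a CM elliptic curve with CM by
# `k` and two non-isogenous simple CM threefolds with CM by a NON-Galois sextic CM field `K ⊇ k` (intrinsic form)

Cell `pub-hodgecm2` (COR-CM), seat b30 gen 14 (2026-08-21); COUNT-NEUTRAL; theorems only, no definition, no named fact,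
no `sorry`.  The intrinsic form of `CorCM/DihedralSexticPairCurveHodgeOfMarkman.lean`: the FRAME hypotheses of
`DihedralSexticPairCurve.hodgeConjectureFor_biproduct_curveSlots_of_frame_of_markman` (`e`, `he_conj`, `he_sign`,
`he_gal`, `hΨ`, `hΦ`, `τ(δ) = i√d`) are DERIVED from

* a family of CM fields `Kf : I → Type` with `k = Kf i₀` of degree `2` and `K = Kf i₁` of degree `6`, NOT Galois over
  `ℚ`, `i : k →+* K` (so `K = k·F₀`, `F₀ = K⁺` a non-cyclic totally real cubic);
* realisations `A₃ j ⊨ (Kf (curveSlots i₀ i₁ j); Φ₃ j)` (`IsCMTypeRealisation`) over the slot family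
  `curveSlots i₀ i₁ = (i₀, i₁, i₁)`: `A₃ 0 = E` a CM elliptic curve of `k` (ANY type `Φ₃ 0` — it is a singleton),
  `A₃ (m+1) = B_m` with types `Φ_m = Φ₃ (m+1)` NOT induced from `k` (`hprim`) and inequivalent under `Aut(K) = {1, c}`
  (`Φ₁ ≠ Φ₀`, `Φ₁ ≠ Φ̄₀ = Φ₀ᶜ`; `B₀ ≁ B₁`);

as follows (§3): `τ :=` THE member of `Φ₃ 0`; `δ ∈ 𝓞_k` with `δ² = -d`, `τ(δ) = i√d`
(`exists_sq_eq_neg_nat_and_apply_eq`); a threefold slot whose type has two members over `τ` is replaced by the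
conjugate realisation of `Φ̄` on the same variety (`exists_realisation_conj_succ`: `Function.update` +
`IsCMTypeRealisation.transport` along `c_K`), which has one (`card_fibre_mem_eq_one_of_compl`); then the frame is
read off by `DihedralSexticPair.exists_frame_of_card_fibre_eq_one` (§1, the frame-reading step of
`CorCM/DihedralSexticPairHodgeOfMarkmanNonGalois.lean` isolated as a lemma) and
`hodgeConjectureFor_biproduct_curveSlots_of_frame_of_markman` applies (§2).

MAIN: `hodgeConjectureFor_biproduct_curveSlots_of_not_isGalois_of_markman` — **`HodgeConjectureFor (⨁ A₃)`, every
rational `(p,p)`-class on the abelian sevenfold `E × B₀ × B₁` is algebraic, GIVEN ONLY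
`Markman2025_weilClasses_algebraic_abelianFourfold`**; and `…_of_avDominatedBy_…` (its isogeny factors).  HONEST
FRAMING: conditional on Markman only; `HC_CM` is not asserted; powers `E^a × B₀^b × B₁^c` are NOT covered.

## References
* [Markman2025SurveySecant] E. Markman, arXiv:2509.23403, Thm. 1.2 and §11.5 Step 2.
* [Pohlmann1968] H. Pohlmann, Ann. of Math. 88 (1968), Thm 1.  [GaoUllmo2025] Z. Gao, E. Ullmo, J. Inst. Math. Jussieu
  25 (2025), Thm 3.1.  [MoonenZarhin1999LowDim] B. Moonen, Yu. Zarhin, Duke Math. J. 98 (1999), Thm. 0.1.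
* [Shimura1998] G. Shimura, *Abelian Varieties with CM and Modular Functions* (1998), §5.2, §8.4, §18.2.
  [Lang2002] S. Lang, *Algebra*, 3rd ed., VI §1.
-/

noncomputable section

open CategoryTheory CategoryTheory.Limits NumberField

/-! ## §1 Reading two types with one member each over `τ` in a frame (pair level) -/

namespace Summit.HodgeConjecture.CorCM.DihedralSexticPair

open Literature.AlgebraicGeometry Literature.AlgebraicGeometry.Motives Literature.AlgebraicGeometry.HodgeTheory
open Summit.HodgeConjecture.CorCM.NonGaloisField

open scoped Classical

section Counting

variable {K : Type} [Field K] [NumberField K] {k : Type} [Field k] {i : k →+* K} {τ : k →+* ℂ}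
  (hττ : ComplexEmbedding.conjugate τ ≠ τ)
  (hdich : ∀ s : K →+* ℂ, s.comp i = τ ∨ s.comp i = ComplexEmbedding.conjugate τ)

include hττ hdich in
/-- **If a type `Φ` has two members over `τ`, the complementary type `Φ'` (`Φ'.1 = Φ.1ᶜ`, i.e. `Φ̄`) has one**: the
`τ̄`-members of `Φ'` are the conjugates of the `τ`-members of `Φ`, and `τ`- and `τ̄`-members of `Φ'` number three.
[cite: Shimura1998, §5.2] -/
theorem card_fibre_mem_eq_one_of_compl (h6 : Module.finrank ℚ K = 6) {Φ Φ' : CMType K}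
    (hΦ' : ∀ s, s ∈ Φ'.1 ↔ s ∉ Φ.1)
    (h12 : (Finset.univ.filter fun s : K →+* ℂ => s.comp i = τ ∧ s ∈ Φ.1).card = 2) :
    (Finset.univ.filter fun s : K →+* ℂ => s.comp i = τ ∧ s ∈ Φ'.1).card = 1 := by
  have hsum := card_fibre_mem_add hττ hdich h6 Φ'
  have heq : (Finset.univ.filter fun s : K →+* ℂ =>
      s.comp i = ComplexEmbedding.conjugate τ ∧ s ∈ Φ'.1) =
      (Finset.univ.filter fun s : K →+* ℂ => s.comp i = τ ∧ s ∈ Φ.1).image ComplexEmbedding.conjugate := by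
    ext s
    simp only [Finset.mem_filter, Finset.mem_univ, true_and, Finset.mem_image, hΦ']
    constructor
    · rintro ⟨hs1, hs2⟩
      refine ⟨ComplexEmbedding.conjugate s, ⟨?_, ?_⟩, ComplexEmbedding.involutive_conjugate K s⟩
      · rw [conjugate_comp, hs1, ComplexEmbedding.involutive_conjugate k τ]
      · by_contra h3
        exact hs2 ((Φ.2 s).2 h3)
    · rintro ⟨s', ⟨hs1, hs2⟩, rfl⟩
      exact ⟨by rw [conjugate_comp, hs1], (Φ.2 s').1 hs2⟩
  rw [heq, Finset.card_image_of_injective _ (ComplexEmbedding.involutive_conjugate K).injective, h12] at hsum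
  omega

end Counting

section Frame

variable {K : Type} [Field K] [NumberField K] [IsCMField K] {k : Type} [Field k] {i : k →+* K} {τ : k →+* ℂ}
  (hττ : ComplexEmbedding.conjugate τ ≠ τ)
  (hdich : ∀ s : K →+* ℂ, s.comp i = τ ∨ s.comp i = ComplexEmbedding.conjugate τ)

include hττ hdich in
/-- **The frame reading two CM types.**  `K/ℚ` not Galois of degree `6`, `Hom(K, ℂ) → Hom(k, ℂ) = {τ, τ̄}` along `i`,
and two types `Φ₀ ≠ Φ₁` of `K` with exactly one member `s_j ∈ Φ_j` over `τ`: there is a frame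
`e : Hom(K, ℂ) ≃ ℤ/3 × Bool` (conjugation flips the sign, sign `true` iff over `τ`, the six sign-preserving maps
`(p, b) ↦ (±p + j, b)` realised by `Aut(ℂ)`) in which `Φ_j = {sign = [place = j]}` — enumerate the `τ`-fibre as
`(s₀, s₁, s₂)` and take `NonGaloisField.exists_frame`.  (The frame-reading step of
`hodgeConjectureFor_biproduct_of_card_fibre_eq_one_of_markman`, isolated.) [cite: Lang2002, VI §1 Thm. 1.14]
[cite: Shimura1998, §18.2] -/
theorem exists_frame_of_card_fibre_eq_one (hK : ¬ IsGalois ℚ K) (h6 : Module.finrank ℚ K = 6)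
    {Φ : Fin 2 → CMType K}
    (hone : ∀ j : Fin 2, (Finset.univ.filter fun s : K →+* ℂ => s.comp i = τ ∧ s ∈ (Φ j).1).card = 1)
    (hne : (Φ 0).1 ≠ (Φ 1).1) :
    ∃ e : (K →+* ℂ) ≃ ZMod 3 × Bool,
      (∀ s : K →+* ℂ, e (ComplexEmbedding.conjugate s) = ((e s).1, !(e s).2)) ∧
      (∀ s : K →+* ℂ, s.comp i = τ ↔ (e s).2 = true) ∧
      (∀ (j : ZMod 3) (f : Bool), ∃ σ : ℂ ≃+* ℂ, ∀ s : K →+* ℂ,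
        e ((σ : ℂ →+* ℂ).comp s) = ((if f then -(e s).1 else (e s).1) + j, (e s).2)) ∧
      (∀ (j : Fin 2) (s : K →+* ℂ), s ∈ (Φ j).1 ↔ (e s).2 = decide ((e s).1.val = j.val)) := by
  -- the distinguished members `s₀ ∈ Φ₀`, `s₁ ∈ Φ₁` over `τ`
  have hsj : ∀ j : Fin 2, ∃ sj : K →+* ℂ, (sj.comp i = τ ∧ sj ∈ (Φ j).1) ∧
      ∀ s : K →+* ℂ, s.comp i = τ → s ∈ (Φ j).1 → s = sj := fun j => by
    obtain ⟨sj, hsj⟩ := Finset.card_eq_one.1 (hone j)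
    have hmem : ∀ s, s ∈ (Finset.univ.filter fun s : K →+* ℂ => s.comp i = τ ∧ s ∈ (Φ j).1) ↔ s = sj := by
      intro s; rw [hsj, Finset.mem_singleton]
    refine ⟨sj, by simpa using (hmem sj).2 rfl, fun s h1 h2 => (hmem s).1 (by simp [h1, h2])⟩
  choose sj hsj husj using hsj
  have h01 : sj 0 ≠ sj 1 := by
    intro heq
    apply hne
    refine cmType_ext_of_fibre hdich fun s hs => ⟨fun h => ?_, fun h => ?_⟩
    · rw [husj 0 s hs h, heq]; exact (hsj 1).2
    · rw [husj 1 s hs h, ← heq]; exact (hsj 0).2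
  -- a third member of the fibre
  obtain ⟨s₂, hs₂, hs₂0, hs₂1⟩ : ∃ s₂ : K →+* ℂ, s₂.comp i = τ ∧ s₂ ≠ sj 0 ∧ s₂ ≠ sj 1 := by
    by_contra hno
    push Not at hno
    have hsub : (Finset.univ.filter fun s : K →+* ℂ => s.comp i = τ) ⊆ {sj 0, sj 1} := by
      intro s hs
      rw [Finset.mem_filter] at hs
      rw [Finset.mem_insert, Finset.mem_singleton]
      by_cases h0 : s = sj 0
      · exact Or.inl h0
      · exact Or.inr (hno s hs.2 h0)
    have hle := Finset.card_le_card hsub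
    rw [card_fibre_eq_three hττ hdich h6, Finset.card_pair h01] at hle
    omega
  -- the enumeration `t = (s₀, s₁, s₂)` of the `τ`-fibre
  set t : ZMod 3 → (K →+* ℂ) := ![sj 0, sj 1, s₂] with ht_def
  have ht0 : t 0 = sj 0 := rfl
  have ht1 : t 1 = sj 1 := rfl
  have hti : ∀ p, (t p).comp i = τ := by
    intro p; fin_cases p
    · exact (hsj 0).1
    · exact (hsj 1).1
    · exact hs₂
  have ht : Function.Injective t := by
    intro p q hpq
    fin_cases p <;> fin_cases q
    · rfl
    · exact absurd hpq h01
    · exact absurd hpq fun h => hs₂0 h.symm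
    · exact absurd hpq (Ne.symm h01)
    · rfl
    · exact absurd hpq fun h => hs₂1 h.symm
    · exact absurd hpq hs₂0
    · exact absurd hpq hs₂1
    · rfl
  obtain ⟨e, het, hec, hcases, he_conj, he_sign, he_gal⟩ := exists_frame hττ hdich ht hti hK h6
  -- the types read in the frame
  have hmemt : ∀ (j : Fin 2) (p : ZMod 3), t p ∈ (Φ j).1 ↔ p.val = j.val := by
    intro j p
    fin_cases j
    · constructor
      · intro h
        have := ht ((husj 0 (t p) (hti p) h).trans ht0.symm)
        rw [this]; rfl
      · intro h
        have hp : p = 0 := Fin.ext h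
        rw [hp, ht0]; exact (hsj 0).2
    · constructor
      · intro h
        have := ht ((husj 1 (t p) (hti p) h).trans ht1.symm)
        rw [this]; rfl
      · intro h
        have hp : p = 1 := Fin.ext h
        rw [hp, ht1]; exact (hsj 1).2
  refine ⟨e, he_conj, he_sign, he_gal, fun j s => ?_⟩
  obtain ⟨p, rfl | rfl⟩ := hcases s
  · rw [het, hmemt]
    simp
  · rw [hec, (Φ j).2, ComplexEmbedding.involutive_conjugate K, hmemt]
    simp

end Frame

end Summit.HodgeConjecture.CorCM.DihedralSexticPair

/-! ## §2 The normalised case for `E × B₀ × B₁` -/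

namespace Summit.HodgeConjecture.CorCM.DihedralSexticPairCurve

open Literature.AlgebraicGeometry Literature.AlgebraicGeometry.Motives Literature.AlgebraicGeometry.HodgeTheory
open Literature.AlgebraicGeometry.ComplexMultiplication (IsCMTypeRealisation)
open Literature.NumberTheory.Automorphic.PicardCM.CMCode (cmTypeMap)

open scoped Classical

variable {I : Type} {Kf : I → Type} [∀ i, Field (Kf i)] [∀ i, NumberField (Kf i)] [∀ i, IsCMField (Kf i)]
  {i₀ i₁ : I}
  {A₃ : Fin 3 → AbelianVariety ℂ} {Φ₃ : ∀ j : Fin 3, CMType (Kf (curveSlots i₀ i₁ j))}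
  {ι₃ : ∀ j, 𝓞 (Kf (curveSlots i₀ i₁ j)) →+* End (A₃ j)}
  {θ₃ : ∀ j, Kf (curveSlots i₀ i₁ j) →+* Module.End ℂ (complexBetti (A₃ j).X 1)}

/-- **For every embedding `τ` of an imaginary quadratic field `k` there are `δ ∈ 𝓞_k` and `d > 0` with `δ² = -d` and
`τ(δ) = i√d`** (replace `δ` by `-δ` if `τ(δ) = -i√d`). [folklore] -/
theorem exists_sq_eq_neg_nat_and_apply_eq (h2 : Module.finrank ℚ (Kf i₀) = 2) (τ : Kf i₀ →+* ℂ) :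
    ∃ (δ : 𝓞 (Kf i₀)) (d : ℕ), 0 < d ∧ ((δ : Kf i₀)) ^ 2 = -(d : Kf i₀) ∧
      τ (δ : Kf i₀) = Complex.I * (Real.sqrt d : ℂ) := by
  obtain ⟨δ, d, hd, hδ⟩ := CyclicSextic.exists_sq_eq_neg_nat_of_isTotallyComplex (Kf i₀) h2
  obtain ⟨τ₀, hτ₀⟩ := WeilFourfold.exists_apply_eq_I_mul_sqrt hδ
  rcases DihedralSexticPair.eq_or_eq_conjugate h2 hd hτ₀ τ with rfl | rfl
  · exact ⟨δ, d, hd, hδ, hτ₀⟩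
  · refine ⟨-δ, d, hd, by push_cast; rw [neg_sq]; exact hδ, ?_⟩
    push_cast
    rw [map_neg, ComplexEmbedding.conjugate_coe_eq, hτ₀, map_mul, Complex.conj_I, Complex.conj_ofReal]
    ring

/-- **The normalised case.**  `K = Kf i₁` not Galois, `τ(δ) = i√d`, `Φ₃ 0 = {τ}`, and exactly one member of each
threefold type `Φ₃ (m+1)` extends `τ`, `Φ₃ 1 ≠ Φ₃ 2`: then `HodgeConjectureFor (⨁ A₃)` modulo Markman — read the two
threefold types in the frame of `DihedralSexticPair.exists_frame_of_card_fibre_eq_one` and apply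
`hodgeConjectureFor_biproduct_curveSlots_of_frame_of_markman`. [cite: Markman2025SurveySecant, Thm. 1.2]
[cite: Lang2002, VI §1] -/
theorem hodgeConjectureFor_biproduct_curveSlots_of_card_fibre_eq_one_of_markman
    (hW4 : Markman2025_weilClasses_algebraic_abelianFourfold)
    (h6 : Module.finrank ℚ (Kf i₁) = 6) (h2 : Module.finrank ℚ (Kf i₀) = 2) (i : Kf i₀ →+* Kf i₁)
    (hK : ¬ IsGalois ℚ (Kf i₁))
    {δ : 𝓞 (Kf i₀)} {d : ℕ} (hd : 0 < d) (hδ : ((δ : Kf i₀)) ^ 2 = -(d : Kf i₀))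
    {τ : Kf i₀ →+* ℂ} (hτ : τ (δ : Kf i₀) = Complex.I * (Real.sqrt d : ℂ))
    (hA : ∀ j, IsCMTypeRealisation (Φ₃ j) (A₃ j) (ι₃ j) (θ₃ j))
    (hΨ : ∀ σ : Kf i₀ →+* ℂ, σ ∈ (Φ₃ 0).1 ↔ σ = τ)
    (hone : ∀ m : Fin 2,
      (Finset.univ.filter fun s : Kf i₁ →+* ℂ => s.comp i = τ ∧ s ∈ (Φ₃ m.succ).1).card = 1)
    (hne : (Φ₃ (Fin.succ 0)).1 ≠ (Φ₃ (Fin.succ 1)).1) :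
    HodgeConjectureFor (⨁ A₃).dim (⨁ A₃).X := by
  have hττ : ComplexEmbedding.conjugate τ ≠ τ := CMThreefoldPair.conjugate_ne_of_apply_eq hd hτ
  have hdich : ∀ s : Kf i₁ →+* ℂ, s.comp i = τ ∨ s.comp i = ComplexEmbedding.conjugate τ := fun s =>
    DihedralSexticPair.eq_or_eq_conjugate h2 hd hτ (s.comp i)
  obtain ⟨e, he_conj, he_sign, he_gal, hΦ⟩ :=
    DihedralSexticPair.exists_frame_of_card_fibre_eq_one hττ hdich hK h6 (Φ := fun m : Fin 2 => Φ₃ m.succ) hone hne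
  exact hodgeConjectureFor_biproduct_curveSlots_of_frame_of_markman hW4 h6 h2 i hd hδ hτ hA e he_conj he_sign he_gal
    hΨ hΦ

/-! ## §3 Normalising: conjugating the realisation of a threefold slot -/

/-- **Conjugating one threefold slot.**  Replacing the realisation `B_m ⊨ (K; Φ_m)` by the conjugate realisation
`B_m ⊨ (K; Φ̄_m)` (`IsCMTypeRealisation.transport` along `c_K`; `Function.update` at the slot `m+1`) yields realisation
data on the SAME varieties `A₃` with the other types unchanged and `Φ̄_m = Φ_mᶜ`. [cite: Shimura1998, §5.2] -/
theorem exists_realisation_conj_succ (hA : ∀ j, IsCMTypeRealisation (Φ₃ j) (A₃ j) (ι₃ j) (θ₃ j)) (m : Fin 2) :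
    ∃ (Φ₃' : ∀ j : Fin 3, CMType (Kf (curveSlots i₀ i₁ j)))
      (ι₃' : ∀ j, 𝓞 (Kf (curveSlots i₀ i₁ j)) →+* End (A₃ j))
      (θ₃' : ∀ j, Kf (curveSlots i₀ i₁ j) →+* Module.End ℂ (complexBetti (A₃ j).X 1)),
      (∀ j, IsCMTypeRealisation (Φ₃' j) (A₃ j) (ι₃' j) (θ₃' j)) ∧
      (∀ j, j ≠ m.succ → Φ₃' j = Φ₃ j) ∧ (Φ₃' m.succ).1 = (Φ₃ m.succ).1ᶜ := by
  set c : Kf i₁ ≃+* Kf i₁ := (IsCMField.complexConj (Kf i₁)).toRingEquiv with hc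
  refine ⟨Function.update Φ₃ m.succ (cmTypeMap c (Φ₃ m.succ)),
    Function.update ι₃ m.succ ((ι₃ m.succ).comp (RingOfIntegers.mapRingEquiv c.symm).toRingHom),
    Function.update θ₃ m.succ ((θ₃ m.succ).comp c.symm.toRingHom), fun j => ?_,
    fun j hj => Function.update_of_ne hj _ _, ?_⟩
  · by_cases hj : j = m.succ
    · subst hj
      rw [Function.update_self, Function.update_self, Function.update_self]
      exact (hA m.succ).transport c
    · rw [Function.update_of_ne hj, Function.update_of_ne hj, Function.update_of_ne hj]
      exact hA j
  · rw [Function.update_self]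
    ext s
    rw [Set.mem_compl_iff]
    exact DihedralSexticPair.mem_cmTypeMap_complexConj_iff (Φ₃ m.succ) s

/-- **With the curve slot pinning `τ` and the first threefold slot normalised** (one member of `Φ₃ 1` over `τ`), the
Hodge conjecture for `⨁ A₃` modulo Markman: if `Φ₃ 2` has two members over `τ`, conjugate that slot
(`exists_realisation_conj_succ`), after which it has one (`card_fibre_mem_eq_one_of_compl`).
[cite: Markman2025SurveySecant, Thm. 1.2] [cite: Shimura1998, §5.2, §8.4] -/
theorem hodgeConjectureFor_biproduct_curveSlots_of_card_fibre_one_eq_one_of_markman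
    (hW4 : Markman2025_weilClasses_algebraic_abelianFourfold)
    (h6 : Module.finrank ℚ (Kf i₁) = 6) (h2 : Module.finrank ℚ (Kf i₀) = 2) (i : Kf i₀ →+* Kf i₁)
    (hK : ¬ IsGalois ℚ (Kf i₁))
    {δ : 𝓞 (Kf i₀)} {d : ℕ} (hd : 0 < d) (hδ : ((δ : Kf i₀)) ^ 2 = -(d : Kf i₀))
    {τ : Kf i₀ →+* ℂ} (hτ : τ (δ : Kf i₀) = Complex.I * (Real.sqrt d : ℂ))
    (hA : ∀ j, IsCMTypeRealisation (Φ₃ j) (A₃ j) (ι₃ j) (θ₃ j))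
    (hΨ : ∀ σ : Kf i₀ →+* ℂ, σ ∈ (Φ₃ 0).1 ↔ σ = τ)
    (hone : (Finset.univ.filter fun s : Kf i₁ →+* ℂ => s.comp i = τ ∧ s ∈ (Φ₃ (Fin.succ 0)).1).card = 1)
    (hprim : ∃ s ∈ (Φ₃ (Fin.succ 1)).1, ∃ s' ∈ (Φ₃ (Fin.succ 1)).1, s.comp i ≠ s'.comp i)
    (hne : (Φ₃ (Fin.succ 0)).1 ≠ (Φ₃ (Fin.succ 1)).1) (hne' : (Φ₃ (Fin.succ 1)).1 ≠ (Φ₃ (Fin.succ 0)).1ᶜ) :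
    HodgeConjectureFor (⨁ A₃).dim (⨁ A₃).X := by
  have hττ : ComplexEmbedding.conjugate τ ≠ τ := CMThreefoldPair.conjugate_ne_of_apply_eq hd hτ
  have hdich : ∀ s : Kf i₁ →+* ℂ, s.comp i = τ ∨ s.comp i = ComplexEmbedding.conjugate τ := fun s =>
    DihedralSexticPair.eq_or_eq_conjugate h2 hd hτ (s.comp i)
  rcases DihedralSexticPair.card_fibre_mem_eq_one_or_two hττ hdich h6 hprim with h1 | ⟨h12, -⟩
  · exact hodgeConjectureFor_biproduct_curveSlots_of_card_fibre_eq_one_of_markman hW4 h6 h2 i hK hd hδ hτ hA hΨ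
      (Fin.forall_fin_two.2 ⟨hone, h1⟩) hne
  · -- conjugate the realisation of the slot `2 = succ 1`
    obtain ⟨Φ₃', ι₃', θ₃', hA', hsame, hcompl⟩ := exists_realisation_conj_succ hA 1
    have h0 : Φ₃' 0 = Φ₃ 0 := hsame 0 (by decide)
    have h1' : Φ₃' (Fin.succ 0) = Φ₃ (Fin.succ 0) := hsame _ (by decide)
    refine hodgeConjectureFor_biproduct_curveSlots_of_card_fibre_eq_one_of_markman hW4 h6 h2 i hK hd hδ hτ hA'
      (fun σ => by rw [h0]; exact hΨ σ) (Fin.forall_fin_two.2 ⟨?_, ?_⟩) ?_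
    · rw [h1']; exact hone
    · exact DihedralSexticPair.card_fibre_mem_eq_one_of_compl hττ hdich h6
        (fun s => by rw [hcompl]; exact Iff.rfl) h12
    · rw [h1', hcompl]
      intro h
      exact hne' (eq_compl_comm.1 h)

/-! ## §4 The main theorem -/

/-- **MAIN THEOREM (intrinsic form).  The Hodge conjecture for `E × B₀ × B₁ = ⨁ A₃` modulo Markman's fourfold
theorem**: `k = Kf i₀` an imaginary quadratic field (CM, degree `2`), `K = Kf i₁ ⊇ i(k)` a sextic CM field that is NOT
Galois over `ℚ`, `E = A₃ 0 ⊨ (k; Φ₃ 0)` a CM elliptic curve (any type), `B_m = A₃ (m+1) ⊨ (K; Φ_m)` realisations of types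
not induced from `k` (`hprim`: `B_m` simple CM threefolds) and inequivalent under `Aut(K) = {1, c}` (`Φ₁ ≠ Φ₀, Φ̄₀`:
`B₀ ≁ B₁`) — every rational `(p,p)`-class on the abelian sevenfold `⨁ A₃` is algebraic, for every `p`, GIVEN ONLY
`Markman2025_weilClasses_algebraic_abelianFourfold`.  Proof: `τ :=` the member of `Φ₃ 0`, `δ` with `τ(δ) = i√d`;
conjugate the slot `1` if `Φ₀` has two members over `τ`; then §3.
[cite: Markman2025SurveySecant, Thm. 1.2 and §11.5 Step 2] [cite: Pohlmann1968, Thm 1] [cite: GaoUllmo2025, Thm 3.1]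
[cite: MoonenZarhin1999LowDim, Thm. 0.1] [cite: Shimura1998, §8.4] [cite: Lang2002, VI §1] -/
theorem hodgeConjectureFor_biproduct_curveSlots_of_not_isGalois_of_markman
    (hW4 : Markman2025_weilClasses_algebraic_abelianFourfold)
    (h6 : Module.finrank ℚ (Kf i₁) = 6) (h2 : Module.finrank ℚ (Kf i₀) = 2) (i : Kf i₀ →+* Kf i₁)
    (hK : ¬ IsGalois ℚ (Kf i₁))
    (hA : ∀ j, IsCMTypeRealisation (Φ₃ j) (A₃ j) (ι₃ j) (θ₃ j))
    (hprim : ∀ m : Fin 2, ∃ s ∈ (Φ₃ m.succ).1, ∃ s' ∈ (Φ₃ m.succ).1, s.comp i ≠ s'.comp i)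
    (hne : (Φ₃ (Fin.succ 0)).1 ≠ (Φ₃ (Fin.succ 1)).1) (hne' : (Φ₃ (Fin.succ 1)).1 ≠ (Φ₃ (Fin.succ 0)).1ᶜ) :
    HodgeConjectureFor (⨁ A₃).dim (⨁ A₃).X := by
  -- `τ :=` the member of the curve's type, `δ` adapted to `τ`
  obtain ⟨τ, hΨ⟩ := QuarticCM.exists_mem_iff_eq_of_quadratic h2 (Φ₃ 0)
  obtain ⟨δ, d, hd, hδ, hτ⟩ := exists_sq_eq_neg_nat_and_apply_eq h2 τ
  have hττ : ComplexEmbedding.conjugate τ ≠ τ := CMThreefoldPair.conjugate_ne_of_apply_eq hd hτ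
  have hdich : ∀ s : Kf i₁ →+* ℂ, s.comp i = τ ∨ s.comp i = ComplexEmbedding.conjugate τ := fun s =>
    DihedralSexticPair.eq_or_eq_conjugate h2 hd hτ (s.comp i)
  rcases DihedralSexticPair.card_fibre_mem_eq_one_or_two hττ hdich h6 (hprim 0) with h1 | ⟨h12, -⟩
  · exact hodgeConjectureFor_biproduct_curveSlots_of_card_fibre_one_eq_one_of_markman hW4 h6 h2 i hK hd hδ hτ hA hΨ
      h1 (hprim 1) hne hne'
  · -- conjugate the realisation of the slot `1 = succ 0`
    obtain ⟨Φ₃', ι₃', θ₃', hA', hsame, hcompl⟩ := exists_realisation_conj_succ hA 0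
    have h0 : Φ₃' 0 = Φ₃ 0 := hsame 0 (by decide)
    have h2' : Φ₃' (Fin.succ 1) = Φ₃ (Fin.succ 1) := hsame _ (by decide)
    refine hodgeConjectureFor_biproduct_curveSlots_of_card_fibre_one_eq_one_of_markman hW4 h6 h2 i hK hd hδ hτ hA'
      (fun σ => by rw [h0]; exact hΨ σ) ?_ (by rw [h2']; exact hprim 1) ?_ ?_
    · exact DihedralSexticPair.card_fibre_mem_eq_one_of_compl hττ hdich h6
        (fun s => by rw [hcompl]; exact Iff.rfl) h12
    · rw [hcompl, h2']
      exact Ne.symm hne'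
    · rw [hcompl, h2']
      intro h
      exact hne (h.trans (compl_compl _)).symm

/-- **The Hodge conjecture for every abelian variety dominated by `E × B₀ × B₁`** (its isogeny factors — among them
`E × B₀ × B₁` in any product bracketing, `B_m × E`, `B₀ × B₁`; NOT the powers), intrinsic form, modulo Markman.
[cite: Markman2025SurveySecant, Thm. 1.2] [cite: MumfordAV1970, §19] -/
theorem hodgeConjectureFor_of_avDominatedBy_curveSlots_of_not_isGalois_of_markman
    (hW4 : Markman2025_weilClasses_algebraic_abelianFourfold)
    (h6 : Module.finrank ℚ (Kf i₁) = 6) (h2 : Module.finrank ℚ (Kf i₀) = 2) (i : Kf i₀ →+* Kf i₁)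
    (hK : ¬ IsGalois ℚ (Kf i₁))
    (hA : ∀ j, IsCMTypeRealisation (Φ₃ j) (A₃ j) (ι₃ j) (θ₃ j))
    (hprim : ∀ m : Fin 2, ∃ s ∈ (Φ₃ m.succ).1, ∃ s' ∈ (Φ₃ m.succ).1, s.comp i ≠ s'.comp i)
    (hne : (Φ₃ (Fin.succ 0)).1 ≠ (Φ₃ (Fin.succ 1)).1) (hne' : (Φ₃ (Fin.succ 1)).1 ≠ (Φ₃ (Fin.succ 0)).1ᶜ)
    {B : AbelianVariety ℂ} (hB : Domination.AVDominatedBy B (⨁ A₃)) : HodgeConjectureFor B.dim B.X :=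
  Domination.hodgeConjectureFor_of_avDominatedBy
    (hodgeConjectureFor_biproduct_curveSlots_of_not_isGalois_of_markman hW4 h6 h2 i hK hA hprim hne hne') hB

end Summit.HodgeConjecture.CorCM.DihedralSexticPairCurve

end
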